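import Literature.IUT.HodgeArakelov.ThetaEvaluationSettingModelOfInvClauses
import Literature.IUT.HodgeArakelov.BadPrimeGaussianMonoidsGenuineRecordOrbitOfOrbitLift
import Literature.IUT.HodgeArakelov.BadPrimeGaussianMonoidsGenuineRecordSplittingPair
import Literature.IUT.HodgeArakelov.ThetaEvaluationSettingModelOfOrbitLift
import Literature.IUT.HodgeArakelov.EtaleThetaDataOfSettingCyclotomeTower
import HarnessLib

/-!
# [IUTchII] Prop 2.2 (ii) / Prop 3.1 (i) / Cor 3.5 (ii) at the GENUINE `θ_env` data on the CLASS-LEVEL route: the inversion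
# binder `h14orbit` PRODUCED from the [EtTh] Prop 1.5 (iii) inversion clause (`IsInversionAut` + `InvClauses`), NO function
# carrier on `ι` (proof-only consumer knit of abc-iut-w4-d010's producer p488825)

S. Mochizuki, *Inter-universal Teichmüller theory II*, kurims Dec-2020 manuscript (render IUTchII-kurims-url-5036b4059555):
Prop 2.2 (ii) p. 66 l. 51–62 («… together with the condition of invariance with respect to `ι` [cf. [EtTh], Proposition 1.4,
(ii); the proof of [EtTh], Theorem 1.6, (iii)], determines a specific `μ_{2l}`- … orbit `θ^ι(Π_v) ⊆ θ(Π_v)`»), Rmk 2.1.1 (i)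
p. 65, Cor 2.8 (i) p. 82, Prop 3.1 (i) p. 87 («splittings up to torsion»), Cor 3.5 (ii) p. 95
[claim: Mochizuki2012, status: disputed] (IUTchII §3 Prop 3.1 (i), kurims p.87); S. Mochizuki, *The étale theta function and its
Frobenioid-theoretic manifestations* [EtTh], Publ. RIMS **45** (2009) (refereed; pages = PRIMS journal PDF): Prop 1.4 (ii) p. 22
(«`Θ̈(−Ü) = −Θ̈(Ü)`»), Prop 1.5 (ii)(iii) p. 23 («any inversion automorphism ι … fixes `η̈^Θ + log(O^×_K̈)`, but maps
`log(Ü) + log(O^×_K̈)` to `−log(Ü) + log(O^×_K̈)`»), Thm 1.6 (iii) p. 24–25, Def 2.7 p. 41, Cor 2.19 (ii) p. 64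
[cite: MochizukiEtTh2009, Prop 1.5 (iii) p.23].

Cell `abc-iut`, layer L6, seat abc-iut-w5-d169 (gen 9; holder-of-record lineage of `plan/L6/SUBDAG-IUTchII-Prop-31-33-34.md`,
holder of row IUTchII:Prop2.2(ii) tonight — abc-iut-L6-lead §F v1.19da); cone nodes **IUTchII:Prop2.2(ii)**, **IUTchII:Prop3.1(i)**,
**IUTchII:Cor3.5(ii)**; GAP-LEDGER row D-G-w4d010-2f (binder of record `h14orbit`). PROOF-ONLY companion: NO definition, NO
`Prop` fact, NO instance; every input is consumed BY NAME; nothing landed is edited or restated.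

WHY. D-G-w4d010-2f now has TWO landed producers of the class-level ORBIT binder `h14orbit` (shape p457679/p457998):
(α) the FUNCTION-carrier producer `EtaleThetaDataOfSetting.h14orbit_of_thetaKummer` (abc-iut-L2-t12, p465052) — knitted into the
genuine-record consumers by abc-iut-w4-d035 (p488082) and abc-iut-w5-d169 (p488875); its ι-package {`ιFn`, `hιFn`, `hΛ`, `hιθ`} is
WITNESS-FREE at every tree model (abc-iut-w5-d125 p469482 / p471544, GAP-LEDGER D-G-L2t2-1 21:51:33Z); (β) the CLASS-LEVEL
producer **`EtaleThetaDataOfSetting.h14orbit_of_invClauses`** (abc-iut-w4-d010 gen 13, p488825) from abc-iut-L2-t1's typing of the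
PRINTED inversion clause of [EtTh] Prop 1.5 (iii) — `IsInversionAut ι` + `InvClauses E hιA c` — GRANTED `Compat` + `Prop15ii`
(F-2503), the pointedness clause (h_sq) «`ι² = Ad(δ)`, `δ ∈ Π^tp_Ÿ`» ([IUTchII] Rmk 2.1.1 (i)) and the class-level deck-sign clause
«`ε · η̈^Θ = κ(−1) · η̈^Θ`» ([EtTh] Prop 1.4 (ii) on classes), whose binder heads ARE model-witnessed (`isInversionAut_inversionχq`,
`inversionχq_inversionχq`, `SettingModelChiInvClauses`; abc-iut-c312-2's K4 datum 02:46:55Z). p488825 knits (β) into the node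
IUTchII:Prop2.2(ii) MODEL closers only and defers the genuine-record consumers «by ONE `obtain`» to the row holders. THIS FILE is
that knit — the K-L6 / K4 «re-close-proof» twins of p488082 / p488875 on route (β), at an ARBITRARY theta setting:
* `EtaleThetaDataOfSetting.thetaIota_nonempty_inversion_of_invClauses` — Prop 2.2 (ii) EXISTENCE half at the model
  (`θ^ι(Π_v) ≠ ∅` at `D := etaleThetaDataOfSetting′`, abc-iut-w4-d004's `thetaIota_nonempty_pairRho`);
* `EtaleLevels.horb_toRecord_/hroots_toRecord_inversion_of_invClauses` — the Cor 3.5 (ii) junction inputs at the genuine record,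
  ANY constants (p457998 twins);
* `EtaleLevels.thetaEnv_toRecord_nonempty_and_horbit_inversion_of_invClauses` — «a SPECIFIC `μ_{2l}`-orbit» at the genuine data as
  ONE statement: `θ^{i₀}_env(𝕄_*) ≠ ∅` at ANY produced record (p441594's NV) ∧ the raw `μ_{2l}`-orbit clause read in the limit
  (dag decl `horbit_thetaEnvData_inversion` p439259, abc-iut-w4-d004's file 4) — (R2)(R3) fed as below;
* **`EtaleLevels.splitting_toRecord_padic_of_eval_inversion_of_invClauses`** — [IUTchII] Prop 3.1 (i) «splittings up to torsion»
  over `ℚ̄_pˣ` (junction J3) = abc-iut-w4-d004's closer of record p441594 for the pointed-inversion PAIR `(inversionAlpha C ι hι, ι^Θ)`,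
  (R2)(R3) and `hker` DISCHARGED on route (β).
In every theorem: `h14sign` ⟸ `h14sign_of_prop15iii` (F-0591), `h14free` ⟸ `h14free_of_prop15_of_origin` (F-0591/F-2503/F-2498),
`h14orbit` ⟸ `h14orbit_of_invClauses` (p488825); the `toLZ`-generator `γ` and the deck element `ε` ⟸ `exists_translation_generators`;
the `ℤ`-reversal `hZι` ⟸ `IsInversionAut.toZ_apply`; `hβ` («`ι^Θ ≡ +1` mod `l·Δ_Θ`») is TRIVIAL since `ι^Θ` fixes `Δ_Θ` pointwise
(`IsInversionAut.thetaIso_apply_eq_self`, abc-iut-L2-t1); `hαγ` ⟸ `toLZ_inversionAlpha_generator`; `hker` ⟸ `hfix_of_cyclotomeTower`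
+ `hker_coh_of_fixed` (abc-iut-w4-d041).
RESIDUAL BY NAME (every binder; no raw §2/§3 clause, no `hker`, no `γ`/`ε`/`hZ`/`hβ`): the model/record data; the inversion
automorphism {`ι`, `IsInversionAut ι`, `hι : ι(Π^tp_{X̲̲}) = Π^tp_{X̲̲}`, theta companion `c`, `InvClauses E _ c`, (h_sq) `δ ∈ Π^tp_{Ÿ̲̲}`
with `ι² = Ad(δ)`}; the class-level deck-sign clause `hdeck`; the named facts `IsEtThOrigin` (F-2498) / `Prop15iii` (F-0591) /
`Prop15ii` (F-2503); a `CyclotomeTower` (genuine data); (H1) `PiYddCharacteristic C` (F-2633 at the instance); the Cor 3.5 (K)/(E)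
DATA of p441594 (J3 closer only). HONEST CAVEATS: `InvClauses` is abc-iut-L2-t1's post-freeze typing of the PRINTED [EtTh] Prop 1.5
(iii) inversion clause (not a FACT-LIST row) and stays a hypothesis BY NAME; the class-level deck-sign clause is print's
[EtTh] Prop 1.4 (ii) «`Θ̈(−Ü) = −Θ̈(Ü)`» read on classes (function-level form: abc-iut-w5-d125's `ThetaKummerDeck`); composition of
landed theorems; no side taken on [IUTchIII] Cor 3.12; typed ≠ proved ≠ endorsed; discharged-modulo-named-inputs ≠ proved outright.
-/

noncomputable section

namespace Literature.IUT.HodgeArakelov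

open Literature.AnabelianGeometry.EtaleTheta (ContH1 ThetaSetting)
open Literature.AnabelianGeometry.EtaleTheta
open EtaleThetaDataOfSetting CohomologySystemOfContH1
open _root_.Topology

/-! ### §1. At the model `D := etaleThetaDataOfSetting′`: existence of `θ^ι(Π_v)` on route (β) -/

namespace EtaleThetaDataOfSetting

variable {p : ℕ} [Fact p.Prime] {D : Literature.AnabelianGeometry.EtaleTheta.ThetaSetting p}
  {E : D.EtaleThetaData} {l : ℕ} (C : E.DoubleUnderline l)
  (ι : D.PiTemp ≃ₜ* D.PiTemp) (hι : C.Huu.map ι.toMulEquiv.toMonoidHom = C.Huu) (c : ThetaSetting.ThetaCompanion ι)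

/-- **[IUTchII] Prop 2.2 (ii), EXISTENCE half «a specific `μ_{2l}`-orbit `θ^ι(Π_v)`» AT THE MODEL, route (β)**: for an
INVERSION AUTOMORPHISM `ι` in abc-iut-L2-t1's sense (`IsInversionAut`, `ι(Π^tp_{X̲̲}) = Π^tp_{X̲̲}`, theta companion `c`) satisfying
the [EtTh] Prop 1.5 (iii) inversion clause (`InvClauses`), pointed (`ι² = Ad(δ)`, `δ ∈ Π^tp_{Ÿ̲̲}`), GRANTED the class-level deck-sign
clause and the named facts, the set `θ^ι(Π_v)` of `ι`-invariants up to torsion of `θ(Π_v)` at `D := etaleThetaDataOfSetting′` is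
NONEMPTY for the pair `(inversionAlpha C ι hι, ι^Θ)` — abc-iut-w4-d004's `thetaIota_nonempty_pairRho` with (R2) `hsign`/`hroot` from
abc-iut-w4-d010's `rootLevel_inputs_of_classLevel_orbit` fed with `h14sign_of_prop15iii`, **`h14orbit_of_invClauses`**,
`h14free_of_prop15_of_origin`. [claim: Mochizuki2012, status: disputed] (IUTchII §2 Prop 2.2 (ii), kurims p.66) -/
theorem thetaIota_nonempty_inversion_of_invClauses [hN : (PiYdd C).Normal] [hYN : D.GtpYdd.Normal]
    (hC : D.Compat) (hS : D.Sec2Hyps) (hO : D.IsEtThOrigin) (hchar : PiYddCharacteristic C)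
    (h15 : ThetaSetting.Prop15iii E hC) (h15ii : ThetaSetting.Prop15ii E.toKummerData hC)
    (S : ThetaSetting.{0}) (eS : (Pi C) ≃ₜ* S.PiX) (hl : S.l = l)
    -- the inversion automorphism of [EtTh] Prop 1.5 (iii), pointed
    (hιA : D.IsInversionAut ι) (hInv : ThetaSetting.InvClauses E hιA c)
    (δ : Pi C) (hδYdd : (δ : D.PiTemp) ∈ D.GtpYdd)
    (hιι : ∀ x : D.PiTemp, ι (ι x) = (δ : D.PiTemp) * x * (δ : D.PiTemp)⁻¹)
    -- the class-level deck-sign clause ([EtTh] Prop 1.4 (ii) on classes)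
    (hdeck : ∀ ε : Pi C, (ε : D.PiTemp) ∈ D.GtpY → (ε : D.PiTemp) ∉ D.GtpYdd →
      ContH1.conj D.toTheta D.DeltaTheta (ε : D.PiTemp) E.etaDd =
        D.inflTheta D.GtpYdd (E.kumYdd (E.toKddHat (-1))) * E.etaDd) :
    ∃ t : (coh C).H1 ⊤, t ∈ (etaleThetaDataOfSetting' C hC hS hchar S eS hl).theta ∧
      IsOfFinAddOrder (pairRho C (inversionAlpha C ι hι) c.thetaIso (thetaCompanion_phi C ι hι c)
        (mem_lDeltaTheta_iff_thetaCompanion ι c l) (mem_PiYdd_iff_of_piYddCharacteristic C hchar _) t - t) := by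
  -- a `toLZ`-generator and a deck element of `Ÿ̲̲ → Y̲̲` inside `Π^tp_{X̲̲}` (abc-iut-w4-d010's `exists_translation_generators`)
  obtain ⟨γ, ε, hγ, hε₁, hε₂⟩ := exists_translation_generators C hS
  -- `ι^Θ` fixes `Δ_Θ` pointwise (abc-iut-L2-t1), so the `l·Δ_Θ`-congruence `hβ` is trivial
  have hβ : ∀ a : D.GtpTheta, a ∈ D.DeltaTheta → c.thetaIso a * a⁻¹ ∈ D.lDeltaTheta l := by
    intro a ha
    have hfix : c.thetaIso a = a := hιA.thetaIso_apply_eq_self c ha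
    rw [hfix, mul_inv_cancel]
    exact one_mem _
  obtain ⟨hsign, hroot, -⟩ := rootLevel_inputs_of_classLevel_orbit C ι hι c hS hchar γ ε hγ hε₁ hε₂ δ (fun x => hιι x) hβ
    (h14sign_of_prop15iii C hC hS h15 ε hε₁)
    (h14orbit_of_invClauses C ι hι c hS hchar hιA hInv hC h15ii hδYdd hιι hdeck)
    (h14free_of_prop15_of_origin C hC hO h15 h15ii γ hγ)
  exact thetaIota_nonempty_pairRho C hC hS hchar S eS hl (inversionAlpha C ι hι) c.thetaIso (thetaCompanion_phi C ι hι c)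
    (mem_lDeltaTheta_iff_thetaCompanion ι c l) (mem_PiYdd_iff_of_piYddCharacteristic C hchar _) γ ε hγ hε₁ hε₂
    (toLZ_inversionAlpha_generator C ι hι γ hγ (hιA.toZ_apply _)) hsign hroot

end EtaleThetaDataOfSetting

/-! ### §2. At the GENUINE `θ_env` data / record on route (β): `horbit`, `horb`, `hroots`, non-vacuity, and the J3 closer -/

namespace EtaleLevels

open TemperedThetaMonoids BadPrimeGaussianMonoids

variable {p : ℕ} [Fact p.Prime] {D : Literature.AnabelianGeometry.EtaleTheta.ThetaSetting p}
  {E : D.EtaleThetaData} {l : ℕ} (C : E.DoubleUnderline l) (hC : D.Compat) (hS : D.Sec2Hyps)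
  (hl : l.Prime) (hp2 : p ≠ 2) (hpl : p ≠ l) (hζ : ∃ ζ : D.K, IsPrimitiveRoot ζ (4 * l))
  (mods : ∀ M : ℕ+, D.CyclotomeMod l M)
  (f : contCocycles D.toTheta D.DeltaTheta C.GtpYdduu) (hf : f ∈ C.rootCocycles hC)
  (hmods : ∀ (M M' : ℕ+) (h : (M : ℕ) ∣ (M' : ℕ)) (x : D.lDeltaTheta l),
    MuN.red p M M' h ((mods M').red x) = (mods M).red x)
  (h15 : Literature.AnabelianGeometry.EtaleTheta.ThetaSetting.Prop15iii E hC) (L : C.CuspLabels)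
  (hZ : ∀ M : ℕ+, Nonempty (ModelCyclotomes.lDeltaQuot (C.rigidData (mods M) hC hS h15 L) ≃*
    Literature.IUT.HodgeTheaters.ZHat))
  (hcharY : EtaleThetaDataOfSetting.PiYddCharacteristic C)
  (hlim : Function.Bijective (rigidLimHom C hC hS hl hp2 hpl hζ mods f hf hmods h15 L hZ))
  [(EtaleThetaDataOfSetting.PiYdd C).Normal] [hYN : D.GtpYdd.Normal]
  (hO : D.IsEtThOrigin) (h15ii : ThetaSetting.Prop15ii E.toKummerData hC)
  -- the inversion automorphism of [EtTh] Prop 1.5 (iii), pointed (route (β): NO function carrier on `ι`)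
  (ι : D.PiTemp ≃ₜ* D.PiTemp) (hι : C.Huu.map ι.toMulEquiv.toMonoidHom = C.Huu) (cι : ThetaSetting.ThetaCompanion ι)
  (hιA : D.IsInversionAut ι) (hInv : ThetaSetting.InvClauses E hιA cι)
  (δ : Pi C) (hδYdd : (δ : D.PiTemp) ∈ D.GtpYdd)
  (hιι : ∀ x : D.PiTemp, ι (ι x) = (δ : D.PiTemp) * x * (δ : D.PiTemp)⁻¹)
  -- the class-level deck-sign clause ([EtTh] Prop 1.4 (ii) on classes)
  (hdeck : ∀ ε : Pi C, (ε : D.PiTemp) ∈ D.GtpY → (ε : D.PiTemp) ∉ D.GtpYdd →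
    ContH1.conj D.toTheta D.DeltaTheta (ε : D.PiTemp) E.etaDd =
      D.inflTheta D.GtpYdd (E.kumYdd (E.toKddHat (-1))) * E.etaDd)

include hO h15ii hιA hInv hδYdd hιι hdeck

section AnyConstants

variable {Iota : Type}
  (iota : Iota → ((thetaEnvData C hC hS hl hp2 hpl hζ mods f hf hmods h15 L hZ hcharY hlim).D.coh.lim ≃+
    (thetaEnvData C hC hS hl hp2 hpl hζ mods f hf hmods h15 L hZ hcharY hlim).D.coh.lim))
  {A : Type} [CommGroup A] [MulDistribMulAction (Pi C) A] [TopologicalSpace A] [RootableBy A ℕ]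
  (c : CyclotomeCoefficients (phi C) (D.lDeltaTheta l) A)
  (hA : ∀ b : A, IsOpen (MulAction.stabilizer (Pi C) b : Set (Pi C)))
  (hfi : ∀ b : A, (MulAction.stabilizer (Pi C) b).FiniteIndex)
  (O : Submonoid A)

/-- **The Cor 3.5 (ii) junction input `horb` AT THE GENUINE RECORD, route (β)** ([IUTchII] Cor 2.8 (i) p. 82 / Prop 3.1 (i) p. 87):
`θ^{i₀}_env(𝕄_*)` is ONE `M^×_TM`-orbit, for ANY constants `(A, c, O)` and ANY inversion family with `iota i₀ =` the limit action of
the inversion automorphism `ι` — abc-iut-w4-d010's `horb_toRecord_inversion_of_classLevel_orbit` (p457998) with `h14orbit` ⟸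
`h14orbit_of_invClauses` (p488825). [claim: Mochizuki2012, status: disputed] (IUTchII §2 Cor 2.8 (i), kurims p.82) -/
theorem horb_toRecord_inversion_of_invClauses {Es : Set ℕ+} (τc : D.CyclotomeTower l Es) (hc : Function.Bijective c.hom)
    (hOtors : ∀ a : A, IsOfFinOrder a → a ∈ O ∧ a⁻¹ ∈ O) {i₀ : Iota}
    (hi₀ : iota i₀ = pairRhoLim C (inversionAlpha C ι hι) cι.thetaIso (thetaCompanion_phi C ι hι cι)
      (mem_lDeltaTheta_iff_thetaCompanion ι cι l) (mem_PiYdd_iff_of_piYddCharacteristic C hcharY _))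
    {θ : ((thetaEnvData C hC hS hl hp2 hpl hζ mods f hf hmods h15 L hZ hcharY hlim).toRecord
          (h1LimConjMulAut (phi C) (D.lDeltaTheta l) (PiYdd C))
          (h1LimKummerOn (phi C) (D.lDeltaTheta l) (PiYdd C) c hA hfi O) iota).H}
    (hθ : θ ∈ ((thetaEnvData C hC hS hl hp2 hpl hζ mods f hf hmods h15 L hZ hcharY hlim).toRecord
          (h1LimConjMulAut (phi C) (D.lDeltaTheta l) (PiYdd C))
          (h1LimKummerOn (phi C) (D.lDeltaTheta l) (PiYdd C) c hA hfi O) iota).thetaEnv i₀) :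
    ∀ θ' ∈ ((thetaEnvData C hC hS hl hp2 hpl hζ mods f hf hmods h15 L hZ hcharY hlim).toRecord
          (h1LimConjMulAut (phi C) (D.lDeltaTheta l) (PiYdd C))
          (h1LimKummerOn (phi C) (D.lDeltaTheta l) (PiYdd C) c hA hfi O) iota).thetaEnv i₀,
      ∃ u ∈ ((thetaEnvData C hC hS hl hp2 hpl hζ mods f hf hmods h15 L hZ hcharY hlim).toRecord
          (h1LimConjMulAut (phi C) (D.lDeltaTheta l) (PiYdd C))
          (h1LimKummerOn (phi C) (D.lDeltaTheta l) (PiYdd C) c hA hfi O) iota).units, θ' = u * θ := by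
  obtain ⟨γ, ε, hγ, hε₁, hε₂⟩ := exists_translation_generators C hS
  exact horb_toRecord_inversion_of_classLevel_orbit C hC hS hl hp2 hpl hζ mods f hf hmods h15 L hZ hcharY hlim hO τc ι hι cι γ ε
    hγ hε₁ hε₂ (hιA.toZ_apply _) δ (fun x => hιι x)
    (fun a ha => by
      have hfix : cι.thetaIso a = a := hιA.thetaIso_apply_eq_self cι ha
      rw [hfix, mul_inv_cancel]; exact one_mem _)
    (h14sign_of_prop15iii C hC hS h15 ε hε₁) (h14free_of_prop15_of_origin C hC hO h15 h15ii γ hγ)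
    iota c hA hfi O hc hOtors hi₀ hθ (h14orbit_of_invClauses C ι hι cι hS hcharY hιA hInv hC h15ii hδYdd hιι hdeck)

/-- **Print's root condition `hroots` AT THE GENUINE RECORD, route (β)** ([IUTchII] Cor 3.5 (ii) p. 95, `∞`-level): every
`ϑ ∈ ∞θ^{i₀}_env(𝕄_*)` has a positive power in `M^×_TM · θ^ℕ` — abc-iut-w4-d010's `hroots_toRecord_inversion_of_classLevel_orbit`
(p457998) with `h14orbit` ⟸ `h14orbit_of_invClauses` (p488825). [claim: Mochizuki2012, status: disputed] (IUTchII §3 Cor 3.5 (ii), kurims p.95) -/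
theorem hroots_toRecord_inversion_of_invClauses {Es : Set ℕ+} (τc : D.CyclotomeTower l Es) (hc : Function.Bijective c.hom)
    (hOtors : ∀ a : A, IsOfFinOrder a → a ∈ O ∧ a⁻¹ ∈ O) {i₀ : Iota}
    (hi₀ : iota i₀ = pairRhoLim C (inversionAlpha C ι hι) cι.thetaIso (thetaCompanion_phi C ι hι cι)
      (mem_lDeltaTheta_iff_thetaCompanion ι cι l) (mem_PiYdd_iff_of_piYddCharacteristic C hcharY _))
    {θ : ((thetaEnvData C hC hS hl hp2 hpl hζ mods f hf hmods h15 L hZ hcharY hlim).toRecord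
          (h1LimConjMulAut (phi C) (D.lDeltaTheta l) (PiYdd C))
          (h1LimKummerOn (phi C) (D.lDeltaTheta l) (PiYdd C) c hA hfi O) iota).H}
    (hθ : θ ∈ ((thetaEnvData C hC hS hl hp2 hpl hζ mods f hf hmods h15 L hZ hcharY hlim).toRecord
          (h1LimConjMulAut (phi C) (D.lDeltaTheta l) (PiYdd C))
          (h1LimKummerOn (phi C) (D.lDeltaTheta l) (PiYdd C) c hA hfi O) iota).thetaEnv i₀) :
    ∀ ϑ ∈ ((thetaEnvData C hC hS hl hp2 hpl hζ mods f hf hmods h15 L hZ hcharY hlim).toRecord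
          (h1LimConjMulAut (phi C) (D.lDeltaTheta l) (PiYdd C))
          (h1LimKummerOn (phi C) (D.lDeltaTheta l) (PiYdd C) c hA hfi O) iota).inftyThetaEnv i₀,
      ∃ N : ℕ, 0 < N ∧ ϑ ^ N ∈ splitMonoid ((thetaEnvData C hC hS hl hp2 hpl hζ mods f hf hmods h15 L hZ hcharY hlim).toRecord
          (h1LimConjMulAut (phi C) (D.lDeltaTheta l) (PiYdd C))
          (h1LimKummerOn (phi C) (D.lDeltaTheta l) (PiYdd C) c hA hfi O) iota).units (Submonoid.powers θ) := by
  obtain ⟨γ, ε, hγ, hε₁, hε₂⟩ := exists_translation_generators C hS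
  exact hroots_toRecord_inversion_of_classLevel_orbit C hC hS hl hp2 hpl hζ mods f hf hmods h15 L hZ hcharY hlim hO τc ι hι cι γ
    ε hγ hε₁ hε₂ (hιA.toZ_apply _) δ (fun x => hιι x)
    (fun a ha => by
      have hfix : cι.thetaIso a = a := hιA.thetaIso_apply_eq_self cι ha
      rw [hfix, mul_inv_cancel]; exact one_mem _)
    (h14sign_of_prop15iii C hC hS h15 ε hε₁) (h14free_of_prop15_of_origin C hC hO h15 h15ii γ hγ)
    iota c hA hfi O hc hOtors hi₀ hθ (h14orbit_of_invClauses C ι hι cι hS hcharY hιA hInv hC h15ii hδYdd hιι hdeck)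

end AnyConstants

/-- **[IUTchII] Prop 2.2 (ii) «determines a SPECIFIC `μ_{2l}`-orbit `θ^ι(Π_v)`» AT THE GENUINE `θ_env` DATA, route (β) — read
as EXISTENCE ∧ UNIQUENESS-UP-TO-TORSION in ONE statement** (kurims p. 66 l. 51–62; Prop 3.1 (i) p. 87): for the limit action
`pairRhoLim C (ι|Π^tp_{X̲̲}) ι^Θ …` of an INVERSION AUTOMORPHISM `ι` (`IsInversionAut` + `InvClauses`, pointed), (a) for ANY produced
record `(thetaEnvData …).toRecord act κ iota` whose `i₀`-th inversion is that action, `θ^{i₀}_env(𝕄_*)` is NONEMPTY (abc-iut-w4-d004's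
`thetaEnv_toRecord_nonempty_pairRhoLim`, p441594), and (b) any two `ι`-invariants up to torsion of the image of `θ(Π^tp_{X̲̲})` in
`lim_J H¹(Π^tp_{Ÿ̲̲} ∩ J, l·Δ_Θ)` differ by a torsion class (the dag decl `horbit_thetaEnvData_inversion` p439259 through abc-iut-w4-d010's
`horbit_thetaEnvData_inversion_of_classLevel_orbit` p457998) — both with (R2)(R3) from `rootLevel_inputs_of_classLevel_orbit` fed with
`h14sign_of_prop15iii`, **`h14orbit_of_invClauses`** (p488825), `h14free_of_prop15_of_origin`, and `hker` ⟸ `IsEtThOrigin` + the cyclotome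
tower. The route-(α) twins (function carrier) are `EtaleLevels.thetaEnv_toRecord_nonempty_/horbit_thetaEnvData_inversion_of_thetaKummerOrbit`
(p488875). So the base-point binders `hθ` of `splitting_toRecord_padic_of_eval_inversion_of_invClauses` and of the `horb`/`hroots` twins
above are NOT vacuous on route (β). [claim: Mochizuki2012, status: disputed] (IUTchII §2 Prop 2.2 (ii), kurims p.66) -/
theorem thetaEnv_toRecord_nonempty_and_horbit_inversion_of_invClauses {Es : Set ℕ+} (τc : D.CyclotomeTower l Es)
    {M : Type} [CommMonoid M]
    (act : (modelSystem C hC hS hl hp2 hpl hζ mods f hf hmods h15 L hZ).PiX →*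
      MulAut (Multiplicative (thetaEnvData C hC hS hl hp2 hpl hζ mods f hf hmods h15 L hZ hcharY hlim).cohEnv.lim))
    (κ : M →* Multiplicative (thetaEnvData C hC hS hl hp2 hpl hζ mods f hf hmods h15 L hZ hcharY hlim).cohEnv.lim)
    {Iota : Type}
    (iota : Iota → ((thetaEnvData C hC hS hl hp2 hpl hζ mods f hf hmods h15 L hZ hcharY hlim).D.coh.lim ≃+
      (thetaEnvData C hC hS hl hp2 hpl hζ mods f hf hmods h15 L hZ hcharY hlim).D.coh.lim))
    {i₀ : Iota}
    (hi₀ : iota i₀ = pairRhoLim C (inversionAlpha C ι hι) cι.thetaIso (thetaCompanion_phi C ι hι cι)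
      (mem_lDeltaTheta_iff_thetaCompanion ι cι l) (mem_PiYdd_iff_of_piYddCharacteristic C hcharY _)) :
    (((thetaEnvData C hC hS hl hp2 hpl hζ mods f hf hmods h15 L hZ hcharY hlim).toRecord act κ iota).thetaEnv i₀).Nonempty ∧
      ∀ x ∈ (thetaEnvData C hC hS hl hp2 hpl hζ mods f hf hmods h15 L hZ hcharY hlim).thetaIotaLim
          (pairRhoLim C (inversionAlpha C ι hι) cι.thetaIso (thetaCompanion_phi C ι hι cι)
            (mem_lDeltaTheta_iff_thetaCompanion ι cι l) (mem_PiYdd_iff_of_piYddCharacteristic C hcharY _)),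
        ∀ x' ∈ (thetaEnvData C hC hS hl hp2 hpl hζ mods f hf hmods h15 L hZ hcharY hlim).thetaIotaLim
          (pairRhoLim C (inversionAlpha C ι hι) cι.thetaIso (thetaCompanion_phi C ι hι cι)
            (mem_lDeltaTheta_iff_thetaCompanion ι cι l) (mem_PiYdd_iff_of_piYddCharacteristic C hcharY _)),
          IsOfFinAddOrder (x' - x) := by
  obtain ⟨γ, ε, hγ, hε₁, hε₂⟩ := exists_translation_generators C hS
  have hβ : ∀ a : D.GtpTheta, a ∈ D.DeltaTheta → cι.thetaIso a * a⁻¹ ∈ D.lDeltaTheta l := fun a ha => by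
    have hfix : cι.thetaIso a = a := hιA.thetaIso_apply_eq_self cι ha
    rw [hfix, mul_inv_cancel]; exact one_mem _
  obtain ⟨hsign, hroot, hfree⟩ := rootLevel_inputs_of_classLevel_orbit C ι hι cι hS hcharY γ ε hγ hε₁ hε₂ δ (fun x => hιι x)
    hβ (h14sign_of_prop15iii C hC hS h15 ε hε₁)
    (h14orbit_of_invClauses C ι hι cι hS hcharY hιA hInv hC h15ii hδYdd hιι hdeck)
    (h14free_of_prop15_of_origin C hC hO h15 h15ii γ hγ)
  exact ⟨thetaEnv_toRecord_nonempty_pairRhoLim C hC hS hl hp2 hpl hζ mods f hf hmods h15 L hZ hcharY hlim iota act κ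
      (inversionAlpha C ι hι) cι.thetaIso (thetaCompanion_phi C ι hι cι) (mem_lDeltaTheta_iff_thetaCompanion ι cι l)
      (mem_PiYdd_iff_of_piYddCharacteristic C hcharY _) γ ε hγ hε₁ hε₂
      (toLZ_inversionAlpha_generator C ι hι γ hγ (hιA.toZ_apply _)) hsign hroot hi₀,
    horbit_thetaEnvData_inversion C hC hS hl hp2 hpl hζ mods f hf hmods h15 L hZ hcharY hlim hO τc ι hι cι γ ε hγ hε₁ hε₂
      (hιA.toZ_apply _) hsign hroot hfree⟩

/-- **[IUTchII] Prop 3.1 (i) «splittings up to torsion» over `ℚ̄_pˣ` AT THE GENERIC GENUINE `θ_env` DATA, route (β) — NO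
class-level orbit binder, NO function carrier on `ι`, NO `hker`** (junction J3): abc-iut-w4-d004's closer of record
`splitting_toRecord_padic_of_eval_pairRhoLim` (p441594) for the pointed-inversion PAIR `(inversionAlpha C ι hι, ι^Θ)` of an INVERSION
AUTOMORPHISM `ι` (`IsInversionAut` + `InvClauses`, pointed), with (R2)(R3) ⟸ `rootLevel_inputs_of_classLevel_orbit` fed with
`h14sign_of_prop15iii` / **`h14orbit_of_invClauses`** (p488825) / `h14free_of_prop15_of_origin`, `hαγ` ⟸ `toLZ_inversionAlpha_generator`
(`hZ` from `IsInversionAut.toZ_apply`), `hker` ⟸ `hfix_of_cyclotomeTower` + `hker_coh_of_fixed`. The route-(α) twin is abc-iut-w4-d035's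
`splitting_toRecord_padic_of_eval_inversion_of_thetaKummerOrbit` (p488082). RESIDUAL (all binders): the inversion automorphism
{`ι`, `IsInversionAut ι`, `hι`, companion `cι`, `InvClauses`, (h_sq) `δ`}, the class-level deck-sign clause, `Prop15iii`/`Prop15ii`/
`IsEtThOrigin`, the tower, (H1), the record inputs and the Cor 3.5 (K)/(E) DATA exactly as in p441594.
[claim: Mochizuki2012, status: disputed] (IUTchII §3 Prop 3.1 (i), kurims p.87) -/
theorem splitting_toRecord_padic_of_eval_inversion_of_invClauses {Es : Set ℕ+} (τc : D.CyclotomeTower l Es)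
    {Iota : Type}
    (iota : Iota → ((thetaEnvData C hC hS hl hp2 hpl hζ mods f hf hmods h15 L hZ hcharY hlim).D.coh.lim ≃+
      (thetaEnvData C hC hS hl hp2 hpl hζ mods f hf hmods h15 L hZ hcharY hlim).D.coh.lim))
    {P₀ : TopGroup.{0}} (φ₀ : P₀ →* D.GtpTheta) (s₀ : P₀ →* Pi C)
    (hs₀ : Continuous ((MonoidHom.id (Pi C)).comp s₀))
    (hN : (⊤ : Subgroup P₀).map ((MonoidHom.id (Pi C)).comp s₀) ≤ PiYdd C)
    (hφ : (phi C).comp ((MonoidHom.id (Pi C)).comp s₀) = φ₀)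
    [TopologicalSpace (PadicAlgCl p)ˣ]
    (c : CyclotomeCoefficients (phi C) (D.lDeltaTheta l) (PadicAlgCl p)ˣ)
    (hA : ∀ b : (PadicAlgCl p)ˣ, IsOpen (MulAction.stabilizer (Pi C) b : Set (Pi C)))
    (hfi : ∀ b : (PadicAlgCl p)ˣ, (MulAction.stabilizer (Pi C) b).FiniteIndex)
    (O : Submonoid (PadicAlgCl p)ˣ)
    [MulDistribMulAction P₀ (PadicAlgCl p)ˣ]
    (c₀ : CyclotomeCoefficients φ₀ (D.lDeltaTheta l) (PadicAlgCl p)ˣ)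
    (hA₀ : ∀ b : (PadicAlgCl p)ˣ, IsOpen (MulAction.stabilizer P₀ b : Set P₀))
    (hfi₀ : ∀ b : (PadicAlgCl p)ˣ, (MulAction.stabilizer P₀ b).FiniteIndex)
    (hc : Function.Bijective c.hom) (hOtors : ∀ a : (PadicAlgCl p)ˣ, IsOfFinOrder a → a ∈ O ∧ a⁻¹ ∈ O)
    (hc₀ : Function.Bijective c₀.hom) (hc₀c : ∀ ζ, c₀.hom ζ = c.hom ζ)
    (hact : ∀ (g : P₀) (a : (PadicAlgCl p)ˣ), g • a = s₀ g • a)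
    [((EtaleThetaDataOfSetting.aug C).comp s₀).range.FiniteIndex]
    {i₀ : Iota}
    (hi₀ : iota i₀ = pairRhoLim C (inversionAlpha C ι hι) cι.thetaIso (thetaCompanion_phi C ι hι cι)
      (mem_lDeltaTheta_iff_thetaCompanion ι cι l) (mem_PiYdd_iff_of_piYddCharacteristic C hcharY _))
    {θ : ((thetaEnvData C hC hS hl hp2 hpl hζ mods f hf hmods h15 L hZ hcharY hlim).toRecord
        (h1LimConjMulAut (phi C) (D.lDeltaTheta l) (PiYdd C))
        (h1LimKummerOn (phi C) (D.lDeltaTheta l) (PiYdd C) c hA hfi O) iota).H}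
    (hθ : θ ∈ ((thetaEnvData C hC hS hl hp2 hpl hζ mods f hf hmods h15 L hZ hcharY hlim).toRecord
        (h1LimConjMulAut (phi C) (D.lDeltaTheta l) (PiYdd C))
        (h1LimKummerOn (phi C) (D.lDeltaTheta l) (PiYdd C) c hA hfi O) iota).thetaEnv i₀)
    (R₀ : ((thetaEnvData C hC hS hl hp2 hpl hζ mods f hf hmods h15 L hZ hcharY hlim).toRecord
        (h1LimConjMulAut (phi C) (D.lDeltaTheta l) (PiYdd C))
        (h1LimKummerOn (phi C) (D.lDeltaTheta l) (PiYdd C) c hA hfi O) iota).H →*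
      Multiplicative (h1Lim φ₀ (D.lDeltaTheta l) (⊤ : Subgroup P₀) ⊥))
    (hR₀ : ∀ y, Multiplicative.toAdd (R₀ y) =
      h1LimCongr (D.lDeltaTheta l) ⊤ hφ ⊥
        (h1LimComap (phi C) (D.lDeltaTheta l) ((MonoidHom.id (Pi C)).comp s₀) hs₀ hN
          (AddEquiv.additiveMultiplicative (h1Lim (phi C) (D.lDeltaTheta l) (PiYdd C) ⊥) (Additive.ofMul y))))
    (q : O) (hRθ : R₀ θ = h1LimKummerOn φ₀ (D.lDeltaTheta l) ⊤ c₀ hA₀ hfi₀ O q) (hq : ¬ IsUnit q) :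
    IsSplittingUpToTorsion
        ((thetaEnvData C hC hS hl hp2 hpl hζ mods f hf hmods h15 L hZ hcharY hlim).toRecord
          (h1LimConjMulAut (phi C) (D.lDeltaTheta l) (PiYdd C))
          (h1LimKummerOn (phi C) (D.lDeltaTheta l) (PiYdd C) c hA hfi O) iota).units
        (Submonoid.closure (((thetaEnvData C hC hS hl hp2 hpl hζ mods f hf hmods h15 L hZ hcharY hlim).toRecord
          (h1LimConjMulAut (phi C) (D.lDeltaTheta l) (PiYdd C))
          (h1LimKummerOn (phi C) (D.lDeltaTheta l) (PiYdd C) c hA hfi O) iota).inftyThetaEnv i₀)) ∧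
      IsSplittingUpToTorsion
        ((thetaEnvData C hC hS hl hp2 hpl hζ mods f hf hmods h15 L hZ hcharY hlim).toRecord
          (h1LimConjMulAut (phi C) (D.lDeltaTheta l) (PiYdd C))
          (h1LimKummerOn (phi C) (D.lDeltaTheta l) (PiYdd C) c hA hfi O) iota).units
        (Submonoid.closure (((thetaEnvData C hC hS hl hp2 hpl hζ mods f hf hmods h15 L hZ hcharY hlim).toRecord
          (h1LimConjMulAut (phi C) (D.lDeltaTheta l) (PiYdd C))
          (h1LimKummerOn (phi C) (D.lDeltaTheta l) (PiYdd C) c hA hfi O) iota).thetaEnv i₀)) := by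
  obtain ⟨γ, ε, hγ, hε₁, hε₂⟩ := exists_translation_generators C hS
  obtain ⟨hsign, hroot, hfree⟩ := rootLevel_inputs_of_classLevel_orbit C ι hι cι hS hcharY γ ε hγ hε₁ hε₂ δ (fun x => hιι x)
    (fun a ha => by
      have hfix : cι.thetaIso a = a := hιA.thetaIso_apply_eq_self cι ha
      rw [hfix, mul_inv_cancel]; exact one_mem _)
    (h14sign_of_prop15iii C hC hS h15 ε hε₁)
    (h14orbit_of_invClauses C ι hι cι hS hcharY hιA hInv hC h15ii hδYdd hιι hdeck)
    (h14free_of_prop15_of_origin C hC hO h15 h15ii γ hγ)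
  exact splitting_toRecord_padic_of_eval_pairRhoLim C hC hS hl hp2 hpl hζ mods f hf hmods h15 L hZ hcharY hlim iota φ₀ s₀ hs₀
    hN hφ c hA hfi O c₀ hA₀ hfi₀ hc hOtors (inversionAlpha C ι hι) cι.thetaIso (thetaCompanion_phi C ι hι cι)
    (mem_lDeltaTheta_iff_thetaCompanion ι cι l) (mem_PiYdd_iff_of_piYddCharacteristic C hcharY _) γ ε hγ hε₁ hε₂
    (toLZ_inversionAlpha_generator C ι hι γ hγ (hιA.toZ_apply _)) hsign hroot hfree
    (hker_coh_of_fixed C (hfix_of_cyclotomeTower C hO τc)) hc₀ hc₀c hact hi₀ hθ R₀ hR₀ q hRθ hq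

end EtaleLevels

end Literature.IUT.HodgeArakelov

end
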